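import Summits.HodgeConjecture.HodgeConjecture.Theorems.F0D9opRoad2Boundary
import HarnessLib

/-!
# `F0D9opRoad2Pen` — ★ RE-HOME of `Lines/F0_D9opRoad2.lean`, PART 2 of 6 (size-lint split; cut at a declaration boundary).

Imports (bare lines; provenance here): `Theorems.F0D9opRoad2Boundary` = ★ the previous part of the same `Lines` workfile (size-lint split ×6) · `HarnessLib`.
See PART 1 `Theorems/F0D9opRoad2Boundary.lean` for the full re-home header and the original module docstring (verbatim there). Namespaces and sections KEPT
(re-opened below exactly as they stand at the cut, with their `open`∕`variable` lines replayed); code bytes = the workfile՚s, docstrings included; options preamble repeated from PART 1.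
HC_CM is proved only modulo the 7 printed citations (2 remaining: hLiu418 = stmt-HodgeConjecture-24832, h413 = stmt-HodgeConjecture-24833) until rung 0 closes; a re-home is count-neutral. -/

namespace Summit.HodgeConjecture.HodgeConjecture.Cruxes.HLiu418.F0D9opRoad2
set_option linter.dupNamespace false  -- `Summit.HodgeConjecture.HodgeConjecture.…` BY DESIGN (D-0017), as in `Lines/d6_cm_curve.lean`
open CategoryTheory NumberField IsDedekindDomain MulAction
open scoped Matrix MonObj CategoryTheory.Obj
open MonoidalCategory
open Summit.HodgeConjecture.CorCM.Lines.A3Liu418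
open Literature.AlgebraicGeometry.Motives (AbelianVariety)
open Literature.AlgebraicGeometry.Motives.AbelianVariety (rationalTateModuleMap frobeniusHom zsmul_eq_zsmul_trace_comp_of_pin
  exists_finite_forall_exists_goodReductionAt_homReduction_tateSpecialisation)
open Literature.NumberTheory.GaloisRepresentations
open Literature.NumberTheory.Automorphic Literature.NumberTheory.Automorphic.UnitaryGroup
open Literature.AlgebraicGeometry.ShimuraVarieties.UnitaryCanonicalModel
open Literature.NumberTheory.Automorphic.Liu2021.AppendixC
open Literature.AlgebraicGeometry.Motives (AlgPoints IntegralModel frobeniusOver SchemeOver)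
open Literature.NumberTheory.DiophantineGeometry (geomResidueField)

section Edition5Desk
open Literature.NumberTheory.EllipticCurves (genericFibre)
open Literature.NumberTheory.DiophantineGeometry (specialFibreFunctor)
open IsLocalRing (closedPoint)


/-! ### ED. 5.2 — PEN LEMMAS (F0P5a-p01 (g4), row (b1″) «v0.5», 2026-08-31; = HOME cert `CERT-ED5-PEN-stubC3of.v3.byimport.F0P5a-p01g4.lean`
§0–§2b + §4 stage B pasted into a line-local namespace; the standalone certs CORE f1acbeb6 ∕ PEN v0→v3 carry the history).  Road L-B′: CORE at the
cofinal level `Kc` (generic pointwise two-section bridge ★ p801437∕p805580 + `r₂`-singleton + translate bookkeeping), bijective lift by counting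
(FULL + ★ p810526 `relIndex_inf_map_conj_eq_natCard_orbit` + DEG (a)), push-forward + reindex ★ p808737, `K₁` by ★ p809676. -/

namespace PenLemmas

open AlgebraicGeometry CategoryTheory.Limits IsDedekindDomain.HeightOneSpectrum IsLocalRing
open Literature.NumberTheory.DiophantineGeometry (specResidueField)


/-! ### §0 Two folklore `finsum` identities (copies of the private lemmas of ★ p801437 ∕ ★ p805580) -/

/-- `∑ᶠ` of the constant `1` over a finite type is its cardinality. [folklore] -/
private theorem finsum_one_eq_natCard (α : Type*) [Finite α] : ∑ᶠ _ : α, (1 : ℕ) = Nat.card α := by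
  haveI := Fintype.ofFinite α
  rw [finsum_eq_sum_of_fintype, Finset.sum_const, Finset.card_univ, smul_eq_mul, mul_one, Nat.card_eq_fintype_card]

/-- Pushing a map `Fr` through a finite `∑ᶠ` of singletons equal to `{a} + n • {b}`. [folklore] -/
private theorem finsum_singleton_map_eq {κ β : Type*} [Finite κ] (m : κ → β) (Fr : β → β) {a b a' b' : β} {n : ℕ}
    (h : ∑ᶠ i, ({m i} : Multiset β) = {a} + n • ({b} : Multiset β)) (ha : Fr a = a') (hb : Fr b = b') :
    ∑ᶠ i, ({Fr (m i)} : Multiset β) = {a'} + n • ({b'} : Multiset β) := by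
  subst ha hb
  have hmap : Multiset.map Fr (∑ᶠ i, ({m i} : Multiset β)) = ∑ᶠ i, ({Fr (m i)} : Multiset β) := by
    rw [← Multiset.coe_mapAddMonoidHom, AddMonoidHom.map_finsum _ (Set.toFinite _)]
    simp only [Multiset.coe_mapAddMonoidHom, Multiset.map_singleton]
  rw [← hmap, h, Multiset.map_add, Multiset.map_nsmul, Multiset.map_singleton, Multiset.map_singleton]

/-- `∑ᶠ` over a type all of whose elements equal `i₀` is the value at `i₀`. [folklore] -/
private theorem finsum_eq_of_forall_eq {κ M : Type*} [AddCommMonoid M] (i₀ : κ) (h : ∀ i, i = i₀) (f : κ → M) :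
    ∑ᶠ i, f i = f i₀ := by
  haveI : Unique κ := ⟨⟨i₀⟩, h⟩
  exact (finsum_unique f).trans (congrArg f (h _))

/-! ### §1 Record bookkeeping: a translate `T_r^{N→K}` with `r ∈ t K` is `u ≫ T_t^{K→K}` -/

/-- **`T^{N→K}_r = u^N_K ≫ T^{K→K}_t` whenever `r K = t K`** (`r = t k`, `k ∈ K`: `T_{tk} = T_1 ≫ T_t ≫ T_k = u ≫ T_t ≫ 𝟙` by the
uniqueness of Hecke translates on the curve record, ★ `RecordSystemGS.heckeTranslate_unique` with ★ `isHeckeTranslate_comp`,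
★ `isHeckeTranslate_one_map`, ★ `isHeckeTranslate_id_of_mem`).  This is the `r₂`-bookkeeping of the C3 letter: `K t₂ K ∕ K = {t₂ K}`.
[cite: Milne2005ShimuraVarieties, Thm. 13.6 p. 118 and §5 p. 57 L7–12, p. 58 L3–11] -/
theorem recordHeckeTranslateGS_eq_map_comp_of_coe_eq
    {F : Type} [Field F] [NumberField F] [IsCMField F] {ι₁ : F →+* ℂ} {Jstar : Matrix (Fin 2) (Fin 2) F}
    {K₀ : C5.OpenCompactSubgroup ↥(finAdelic ↥(maximalRealSubfield F) F (IsCMField.complexConj F) 2 Jstar)}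
    (S : RecordSystemGS F Jstar ι₁ K₀) (hU7ₛ : S.HeckeTranslateDefinedOver) {N K : C5.SmallLevel K₀} (hNK : N ≤ K)
    {t r : ↥(finAdelic ↥(maximalRealSubfield F) F (IsCMField.complexConj F) 2 Jstar)}
    (htK : C5.HeckeLE t K K) (hrN : C5.HeckeLE r N K)
    (h : (r : ↥(finAdelic ↥(maximalRealSubfield F) F (IsCMField.complexConj F) 2 Jstar) ⧸
            (K.1.1 : Subgroup ↥(finAdelic ↥(maximalRealSubfield F) F (IsCMField.complexConj F) 2 Jstar)))
         = (t : ↥(finAdelic ↥(maximalRealSubfield F) F (IsCMField.complexConj F) 2 Jstar) ⧸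
            (K.1.1 : Subgroup ↥(finAdelic ↥(maximalRealSubfield F) F (IsCMField.complexConj F) 2 Jstar)))) :
    Literature.NumberTheory.Automorphic.Liu2021.AppendixC.recordHeckeTranslateGS S hU7ₛ r N K hrN = S.M.map (homOfLE hNK) ≫ Literature.NumberTheory.Automorphic.Liu2021.AppendixC.recordHeckeTranslateGS S hU7ₛ t K K htK := by
  have hk : t⁻¹ * r ∈ (K.1.1 : Subgroup ↥(finAdelic ↥(maximalRealSubfield F) F (IsCMField.complexConj F) 2 Jstar)) :=
    QuotientGroup.eq.1 h.symm
  have h1 : S.IsHeckeTranslate N K (1 * t * (t⁻¹ * r))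
      ((S.M.map (homOfLE hNK) ≫ Literature.NumberTheory.Automorphic.Liu2021.AppendixC.recordHeckeTranslateGS S hU7ₛ t K K htK) ≫ 𝟙 (S.M.obj K)) :=
    S.isHeckeTranslate_comp
      (S.isHeckeTranslate_comp (S.isHeckeTranslate_one_map (homOfLE hNK))
        (Literature.NumberTheory.Automorphic.Liu2021.AppendixC.isHeckeTranslate_recordHeckeTranslateGS S hU7ₛ t K K htK))
      (S.isHeckeTranslate_id_of_mem K hk)
  have e : 1 * t * (t⁻¹ * r) = r := by group
  rw [e, Category.comp_id] at h1
  exact S.heckeTranslate_unique (Literature.NumberTheory.Automorphic.Liu2021.AppendixC.isHeckeTranslate_recordHeckeTranslateGS S hU7ₛ r N K hrN) h1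

/- (d1) «M-142e» RETIRED BY DEDUP (desk F0P6a-plan (g7) pre-scan, type identity `rfl`-certified by `F0/P6/F0P6a-plan/g7/d1/D1Probe.parent.v1.F0P6a-plan-g7.lean`, farm rc 0):
   tree :348–:413 = banner «§1b The generic two-section bridge AT ONE POINT» + `section GenericAt` holding the ONE theorem
   `…F0D9opRoad2.PenLemmas.finsum_map_geomReductionMap_map_eq_of_isOpenImmersion_specialFibre_at` (tree :363; 0 external callers; one internal call site, tree :535)
   → `Literature.AlgebraicGeometry.Motives.IntegralModel.finsum_map_geomReductionMap_map_eq_of_isOpenImmersion_specialFibre_at`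
   (`Literature/AlgebraicGeometry/Motives/IntegralModelTwoSectionFibreIdentityAt.lean` :142 — the landed (a)-capital port of this very block; imported in the root part). -/

/-! ### §1c Record: the `r₂`-sum over the singleton orbit `K t₂ K ∕ K = {t₂ K}` is one term `N w • {red (T_{t₂} (u x))}` -/

/-- **The `r₂` side of C3.**  If every element of the `K`-orbit of `t₂ K` equals `t₂ K` (e.g. `t₂` central), then for coset
representatives `r₂ α` the `α`-indexed sum `Σ_α N w • {red_𝒮 (T^{N→K}_{r₂ α} x)}` is the single term `N w • {red_𝒮 (T^{K→K}_{t₂} (u x))}`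
(§1 bookkeeping `T_{r₂ α} = u ≫ T_{t₂}`). [cite: Milne2005ShimuraVarieties, Thm. 13.6 p. 118] [cite: Liu2021, proof of Cor. D.9 p. 139 L4–L10] -/
theorem finsum_smul_singleton_translate_eq_of_orbit_subsingleton
    {F : Type} [Field F] [NumberField F] [IsCMField F] {ι₁ : F →+* ℂ} {Jstar : Matrix (Fin 2) (Fin 2) F}
    {K₀ : C5.OpenCompactSubgroup ↥(finAdelic ↥(maximalRealSubfield F) F (IsCMField.complexConj F) 2 Jstar)}
    (S : RecordSystemGS F Jstar ι₁ K₀) (hU7ₛ : S.HeckeTranslateDefinedOver) {N K : C5.SmallLevel K₀} (hNK : N ≤ K)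
    (w : HeightOneSpectrum (𝓞 F)) (𝒮 : IntegralModel (HeightOneSpectrum.valuationSubringAtPrime F w) F (S.M.obj K))
    [IsProper 𝒮.total.hom]
    (t₂ : ↥(finAdelic ↥(maximalRealSubfield F) F (IsCMField.complexConj F) 2 Jstar)) (ht₂ : C5.HeckeLE t₂ K K)
    (r₂ : ↥(orbit (K.1.1 : Subgroup ↥(finAdelic ↥(maximalRealSubfield F) F (IsCMField.complexConj F) 2 Jstar)) ((t₂ : ↥(finAdelic ↥(maximalRealSubfield F) F (IsCMField.complexConj F) 2 Jstar)) : ↥(finAdelic ↥(maximalRealSubfield F) F (IsCMField.complexConj F) 2 Jstar) ⧸ (K.1.1 : Subgroup ↥(finAdelic ↥(maximalRealSubfield F) F (IsCMField.complexConj F) 2 Jstar)))) → ↥(finAdelic ↥(maximalRealSubfield F) F (IsCMField.complexConj F) 2 Jstar))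
    (hr₂ : ∀ α, ((r₂ α : ↥(finAdelic ↥(maximalRealSubfield F) F (IsCMField.complexConj F) 2 Jstar)) : ↥(finAdelic ↥(maximalRealSubfield F) F (IsCMField.complexConj F) 2 Jstar) ⧸
             (K.1.1 : Subgroup ↥(finAdelic ↥(maximalRealSubfield F) F (IsCMField.complexConj F) 2 Jstar))) = α.1)
    (hrN₂ : ∀ α, C5.HeckeLE (r₂ α) N K)
    (hdeg₂ : ∀ α : ↥(orbit (K.1.1 : Subgroup ↥(finAdelic ↥(maximalRealSubfield F) F (IsCMField.complexConj F) 2 Jstar)) ((t₂ : ↥(finAdelic ↥(maximalRealSubfield F) F (IsCMField.complexConj F) 2 Jstar)) : ↥(finAdelic ↥(maximalRealSubfield F) F (IsCMField.complexConj F) 2 Jstar) ⧸ (K.1.1 : Subgroup ↥(finAdelic ↥(maximalRealSubfield F) F (IsCMField.complexConj F) 2 Jstar)))),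
       (α : ↥(finAdelic ↥(maximalRealSubfield F) F (IsCMField.complexConj F) 2 Jstar) ⧸
             (K.1.1 : Subgroup ↥(finAdelic ↥(maximalRealSubfield F) F (IsCMField.complexConj F) 2 Jstar))) = ((t₂ : ↥(finAdelic ↥(maximalRealSubfield F) F (IsCMField.complexConj F) 2 Jstar)) : ↥(finAdelic ↥(maximalRealSubfield F) F (IsCMField.complexConj F) 2 Jstar) ⧸
             (K.1.1 : Subgroup ↥(finAdelic ↥(maximalRealSubfield F) F (IsCMField.complexConj F) 2 Jstar))))
    (c : ℕ) (x : AlgPoints (S.M.obj N) (AlgebraicClosure (w.adicCompletion F))) :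
    ∑ᶠ α, c • ({𝒮.geomReductionMap (AlgPoints.map (Literature.NumberTheory.Automorphic.Liu2021.AppendixC.recordHeckeTranslateGS S hU7ₛ (r₂ α) N K (hrN₂ α)) x)} : Multiset (AlgPoints 𝒮.reductionAt (geomResidueField w)))
      = c • ({𝒮.geomReductionMap (AlgPoints.map (Literature.NumberTheory.Automorphic.Liu2021.AppendixC.recordHeckeTranslateGS S hU7ₛ t₂ K K ht₂) (AlgPoints.map (S.M.map (homOfLE hNK)) x))} : Multiset (AlgPoints 𝒮.reductionAt (geomResidueField w))) := by
  have α₀ : ↥(orbit (K.1.1 : Subgroup ↥(finAdelic ↥(maximalRealSubfield F) F (IsCMField.complexConj F) 2 Jstar)) ((t₂ : ↥(finAdelic ↥(maximalRealSubfield F) F (IsCMField.complexConj F) 2 Jstar)) : ↥(finAdelic ↥(maximalRealSubfield F) F (IsCMField.complexConj F) 2 Jstar) ⧸ (K.1.1 : Subgroup ↥(finAdelic ↥(maximalRealSubfield F) F (IsCMField.complexConj F) 2 Jstar)))) := ⟨_, mem_orbit_self _⟩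
  have hT : Literature.NumberTheory.Automorphic.Liu2021.AppendixC.recordHeckeTranslateGS S hU7ₛ (r₂ α₀) N K (hrN₂ α₀)
      = S.M.map (homOfLE hNK) ≫ Literature.NumberTheory.Automorphic.Liu2021.AppendixC.recordHeckeTranslateGS S hU7ₛ t₂ K K ht₂ :=
    recordHeckeTranslateGS_eq_map_comp_of_coe_eq S hU7ₛ hNK ht₂ (hrN₂ α₀) ((hr₂ α₀).trans (hdeg₂ α₀))
  rw [finsum_eq_of_forall_eq α₀ (fun α => Subtype.ext ((hdeg₂ α).trans (hdeg₂ α₀).symm)), hT, AlgPoints.map_comp_apply]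

/-- Arithmetic regrouping: `S = a + (n − 1) • b` and `n = q + 1` give `S = a + q • b`. [folklore] -/
private theorem eq_add_smul_of_card {M : Type*} [AddCommMonoid M] {S a b : M} {n q : ℕ} (h : S = a + (n - 1) • b) (hn : n = q + 1) :
    S = a + q • b := by
  rw [h, hn, Nat.add_sub_cancel]

/-! ### §2 The pointwise core for ARBITRARY `t₁ t₂ ∈ G(𝔸_f)` (nothing about `heckeElementAt` is used) -/

/-- **ED. 5 bridge, pointwise core, general `t₁ t₂`.**  For the curve record `S`, levels `N ≤ K ≥ K₁`, elements `t₁ t₂` with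
`t₁⁻¹ K₁ t₁ ⊆ K`, `t₂⁻¹ K t₂ ⊆ K`, proper models `𝒮 ∕ 𝒯` of `M⋆_K ∕ M⋆_{K₁}` over `𝒪_{F,(w)}` carrying the two-section correspondence datum
of the MOD letter (generic fibres `u′ = u^{K₁}_K` and `T_{t₁}`), a BIJECTIVE reindexing `lift` of the `u′`-fibre over `u x` by
`K t₁ K ∕ K` compatible with the translates, `#(K t₁ K ∕ K) = N w + 1` and `K t₂ K ∕ K = {t₂ K}`: the C3 three-term identity at `x`.
[cite: Liu2021, Prop. D.8 (1)–(3) and proof of Cor. D.9 p. 139 L4–L10] [cite: SerreTate1968, §1] -/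
theorem finsum_translate_eq_of_two_sections
    (F : Type) [Field F] [NumberField F] [IsCMField F] [IsGalois ℚ F] (ι₁ : F →+* ℂ)
    (Jstar : Matrix (Fin 2) (Fin 2) F)
    (K₀ : C5.OpenCompactSubgroup ↥(finAdelic ↥(maximalRealSubfield F) F (IsCMField.complexConj F) 2 Jstar))
    (S : RecordSystemGS F Jstar ι₁ K₀) (hU7ₛ : S.HeckeTranslateDefinedOver) (K : C5.SmallLevel K₀)
    (w : HeightOneSpectrum (𝓞 F))
    (𝒮 : IntegralModel (HeightOneSpectrum.valuationSubringAtPrime F w) F (S.M.obj K))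
    [IsProper 𝒮.total.hom]
    (t₁ t₂ : ↥(finAdelic ↥(maximalRealSubfield F) F (IsCMField.complexConj F) 2 Jstar))
    -- (i) the ∃-body of `RecordCurveCongruenceCorrespondence` at `(K₁, hle, ht, hK₁, ht₂)` (clause (3) dropped)
    (K₁ : C5.SmallLevel K₀) (hle : K₁ ≤ K)
    (ht : C5.HeckeLE t₁ K₁ K)
    (ht₂ : C5.HeckeLE t₂ K K)
    (𝒯 : IntegralModel (HeightOneSpectrum.valuationSubringAtPrime F w) F (S.M.obj K₁))
    [IsProper 𝒯.total.hom]
    (π₁ π₂ : 𝒯.total ⟶ 𝒮.total)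
    [Flat π₁.left] [LocallyOfFinitePresentation π₁.left] [IsFinite π₁.left]
    (hπ₁ : (genericFibre (HeightOneSpectrum.valuationSubringAtPrime F w) F).map π₁ ≫ 𝒮.genericIso'.hom
       = 𝒯.genericIso'.hom ≫ S.M.map (homOfLE hle))
    (hπ₂ : (genericFibre (HeightOneSpectrum.valuationSubringAtPrime F w) F).map π₂ ≫ 𝒮.genericIso'.hom
       = 𝒯.genericIso'.hom ≫ Literature.NumberTheory.Automorphic.Liu2021.AppendixC.recordHeckeTranslateGS S hU7ₛ _ K₁ K ht)
    (s s' : AlgPoints 𝒮.reductionAt (geomResidueField w) → AlgPoints 𝒯.reductionAt (geomResidueField w))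
    (V : (𝒯.reductionAt).left.Opens)
    [IsOpenImmersion (V.ι ≫ ((specialFibreFunctor w).map π₁).left)]
    (hcov : ∀ (z : AlgPoints 𝒯.reductionAt (geomResidueField w)) (yb : AlgPoints 𝒮.reductionAt (geomResidueField w)),
        AlgPoints.map ((specialFibreFunctor w).map π₁) z = yb → z = s yb ∨ z = s' yb)
    (hs : ∀ yb : AlgPoints 𝒮.reductionAt (geomResidueField w), AlgPoints.map ((specialFibreFunctor w).map π₁) (s yb) = yb)
    (hV : ∀ yb : AlgPoints 𝒮.reductionAt (geomResidueField w),
        s yb ≠ s' yb → (s yb).toSpecHom.base (closedPoint (geomResidueField w)) ∈ V)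
    (hs₂ : ∀ yb : AlgPoints 𝒮.reductionAt (geomResidueField w),
        AlgPoints.map ((specialFibreFunctor w).map π₂) (s yb) = AlgPoints.map (frobeniusOver 𝒮.reductionAt) yb)
    (hs'₂ : ∀ y : AlgPoints (S.M.obj K) (AlgebraicClosure (w.adicCompletion F)),
        AlgPoints.map (frobeniusOver 𝒮.reductionAt)
            (AlgPoints.map ((specialFibreFunctor w).map π₂) (s' (𝒮.geomReductionMap y)))
          = 𝒮.geomReductionMap (AlgPoints.map (Literature.NumberTheory.Automorphic.Liu2021.AppendixC.recordHeckeTranslateGS S hU7ₛ _ K K ht₂) y))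
    -- (ii) the ∃-body of `HeckeSumReindexing` at `(N, r₁, x)`, PLUS injectivity of the lift
    (N : C5.SmallLevel K₀) (hNK : N ≤ K)
    (r₁ : ↥(orbit (K.1.1 : Subgroup ↥(finAdelic ↥(maximalRealSubfield F) F (IsCMField.complexConj F) 2 Jstar)) ((t₁ : ↥(finAdelic ↥(maximalRealSubfield F) F (IsCMField.complexConj F) 2 Jstar)) : ↥(finAdelic ↥(maximalRealSubfield F) F (IsCMField.complexConj F) 2 Jstar) ⧸ (K.1.1 : Subgroup ↥(finAdelic ↥(maximalRealSubfield F) F (IsCMField.complexConj F) 2 Jstar)))) → ↥(finAdelic ↥(maximalRealSubfield F) F (IsCMField.complexConj F) 2 Jstar))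
    (hrN₁ : ∀ α, C5.HeckeLE (r₁ α) N K)
    (x : AlgPoints (S.M.obj N) (AlgebraicClosure (w.adicCompletion F)))
    (lift : ↥(orbit (K.1.1 : Subgroup ↥(finAdelic ↥(maximalRealSubfield F) F (IsCMField.complexConj F) 2 Jstar)) ((t₁ : ↥(finAdelic ↥(maximalRealSubfield F) F (IsCMField.complexConj F) 2 Jstar)) : ↥(finAdelic ↥(maximalRealSubfield F) F (IsCMField.complexConj F) 2 Jstar) ⧸ (K.1.1 : Subgroup ↥(finAdelic ↥(maximalRealSubfield F) F (IsCMField.complexConj F) 2 Jstar)))) →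
      {y : AlgPoints (S.M.obj K₁) (AlgebraicClosure (w.adicCompletion F)) //
          AlgPoints.map (S.M.map (homOfLE hle)) y = (AlgPoints.map (S.M.map (homOfLE hNK)) x)})
    (hsurj : Function.Surjective lift) (hinj : Function.Injective lift)
    (hliftT : ∀ α, AlgPoints.map (Literature.NumberTheory.Automorphic.Liu2021.AppendixC.recordHeckeTranslateGS S hU7ₛ _ K₁ K ht) (lift α).1
             = AlgPoints.map (Literature.NumberTheory.Automorphic.Liu2021.AppendixC.recordHeckeTranslateGS S hU7ₛ (r₁ α) N K (hrN₁ α)) x)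
    -- (iii) the degree of `T_𝔭`: `#(K t₁ K ∕ K) = N w + 1`
    (hdeg₁ : Nat.card ↥(orbit (K.1.1 : Subgroup ↥(finAdelic ↥(maximalRealSubfield F) F (IsCMField.complexConj F) 2 Jstar)) ((t₁ : ↥(finAdelic ↥(maximalRealSubfield F) F (IsCMField.complexConj F) 2 Jstar)) : ↥(finAdelic ↥(maximalRealSubfield F) F (IsCMField.complexConj F) 2 Jstar) ⧸ (K.1.1 : Subgroup ↥(finAdelic ↥(maximalRealSubfield F) F (IsCMField.complexConj F) 2 Jstar)))) = Ideal.absNorm w.asIdeal + 1)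
    -- (iv) the `r₂` side: `K t₂ K ∕ K = {t₂ K}`
    (r₂ : ↥(orbit (K.1.1 : Subgroup ↥(finAdelic ↥(maximalRealSubfield F) F (IsCMField.complexConj F) 2 Jstar)) ((t₂ : ↥(finAdelic ↥(maximalRealSubfield F) F (IsCMField.complexConj F) 2 Jstar)) : ↥(finAdelic ↥(maximalRealSubfield F) F (IsCMField.complexConj F) 2 Jstar) ⧸ (K.1.1 : Subgroup ↥(finAdelic ↥(maximalRealSubfield F) F (IsCMField.complexConj F) 2 Jstar)))) → ↥(finAdelic ↥(maximalRealSubfield F) F (IsCMField.complexConj F) 2 Jstar))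
    (hr₂ : ∀ α, ((r₂ α : ↥(finAdelic ↥(maximalRealSubfield F) F (IsCMField.complexConj F) 2 Jstar)) : ↥(finAdelic ↥(maximalRealSubfield F) F (IsCMField.complexConj F) 2 Jstar) ⧸
             (K.1.1 : Subgroup ↥(finAdelic ↥(maximalRealSubfield F) F (IsCMField.complexConj F) 2 Jstar))) = α.1)
    (hrN₂ : ∀ α, C5.HeckeLE (r₂ α) N K)
    (hdeg₂ : ∀ α : ↥(orbit (K.1.1 : Subgroup ↥(finAdelic ↥(maximalRealSubfield F) F (IsCMField.complexConj F) 2 Jstar)) ((t₂ : ↥(finAdelic ↥(maximalRealSubfield F) F (IsCMField.complexConj F) 2 Jstar)) : ↥(finAdelic ↥(maximalRealSubfield F) F (IsCMField.complexConj F) 2 Jstar) ⧸ (K.1.1 : Subgroup ↥(finAdelic ↥(maximalRealSubfield F) F (IsCMField.complexConj F) 2 Jstar)))),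
       (α : ↥(finAdelic ↥(maximalRealSubfield F) F (IsCMField.complexConj F) 2 Jstar) ⧸
             (K.1.1 : Subgroup ↥(finAdelic ↥(maximalRealSubfield F) F (IsCMField.complexConj F) 2 Jstar))) = ((t₂ : ↥(finAdelic ↥(maximalRealSubfield F) F (IsCMField.complexConj F) 2 Jstar)) : ↥(finAdelic ↥(maximalRealSubfield F) F (IsCMField.complexConj F) 2 Jstar) ⧸
             (K.1.1 : Subgroup ↥(finAdelic ↥(maximalRealSubfield F) F (IsCMField.complexConj F) 2 Jstar)))) :
    ∑ᶠ α, ({AlgPoints.map (frobeniusOver 𝒮.reductionAt)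
               (𝒮.geomReductionMap (AlgPoints.map (Literature.NumberTheory.Automorphic.Liu2021.AppendixC.recordHeckeTranslateGS S hU7ₛ (r₁ α) N K (hrN₁ α)) x))} :
             Multiset (AlgPoints 𝒮.reductionAt (geomResidueField w)))
      = {AlgPoints.map (frobeniusOver 𝒮.reductionAt) (AlgPoints.map (frobeniusOver 𝒮.reductionAt)
            (𝒮.geomReductionMap (AlgPoints.map (S.M.map (homOfLE hNK)) x)))}
        + ∑ᶠ α, Ideal.absNorm w.asIdeal •
            ({𝒮.geomReductionMap (AlgPoints.map (Literature.NumberTheory.Automorphic.Liu2021.AppendixC.recordHeckeTranslateGS S hU7ₛ (r₂ α) N K (hrN₂ α)) x)} :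
              Multiset (AlgPoints 𝒮.reductionAt (geomResidueField w))) := by
  -- the `u′`-fibre over `u x` is in bijection with `K t₁ K ∕ K`: finite, non-empty, of cardinality `N w + 1`
  haveI := Nat.finite_of_card_ne_zero (ne_of_eq_of_ne hdeg₁ (Nat.succ_ne_zero _))
  have hfinFib : Finite {y : AlgPoints (S.M.obj K₁) (AlgebraicClosure (w.adicCompletion F)) //
          AlgPoints.map (S.M.map (homOfLE hle)) y = (AlgPoints.map (S.M.map (homOfLE hNK)) x)} :=
    Finite.of_equiv _ (Equiv.ofBijective lift ⟨hinj, hsurj⟩)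
  have hneFib : Nonempty {y : AlgPoints (S.M.obj K₁) (AlgebraicClosure (w.adicCompletion F)) //
          AlgPoints.map (S.M.map (homOfLE hle)) y = (AlgPoints.map (S.M.map (homOfLE hNK)) x)} :=
    ⟨lift ⟨_, mem_orbit_self _⟩⟩
  have hcard : Nat.card {y : AlgPoints (S.M.obj K₁) (AlgebraicClosure (w.adicCompletion F)) //
          AlgPoints.map (S.M.map (homOfLE hle)) y = (AlgPoints.map (S.M.map (homOfLE hNK)) x)}
      = Ideal.absNorm w.asIdeal + 1 :=
    (Nat.card_congr (Equiv.ofBijective lift ⟨hinj, hsurj⟩)).symm.trans hdeg₁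
  -- the generic two-section bridge at the point `u x` (§1b), `Fr := F` on points, `g := red_𝒮 ∘ T_{t₂}`
  have hB := eq_add_smul_of_card
    (Literature.AlgebraicGeometry.Motives.IntegralModel.finsum_map_geomReductionMap_map_eq_of_isOpenImmersion_specialFibre_at 𝒮 𝒯 π₁ π₂
      (S.M.map (homOfLE hle)) (Literature.NumberTheory.Automorphic.Liu2021.AppendixC.recordHeckeTranslateGS S hU7ₛ _ K₁ K ht) hπ₁ hπ₂ s s' hcov hs V hV
      (AlgPoints.map (L := geomResidueField w) (frobeniusOver 𝒮.reductionAt)) hs₂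
      (fun y => 𝒮.geomReductionMap (AlgPoints.map (Literature.NumberTheory.Automorphic.Liu2021.AppendixC.recordHeckeTranslateGS S hU7ₛ _ K K ht₂) y)) hs'₂
      (AlgPoints.map (S.M.map (homOfLE hNK)) x) hfinFib hneFib) hcard
  -- reindex the `r₁`-sum along the bijective lift (Γ3-Q)
  have hL : ∑ᶠ α, ({AlgPoints.map (frobeniusOver 𝒮.reductionAt)
        (𝒮.geomReductionMap (AlgPoints.map (Literature.NumberTheory.Automorphic.Liu2021.AppendixC.recordHeckeTranslateGS S hU7ₛ (r₁ α) N K (hrN₁ α)) x))} : Multiset (AlgPoints 𝒮.reductionAt (geomResidueField w)))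
      = ∑ᶠ y : {y : AlgPoints (S.M.obj K₁) (AlgebraicClosure (w.adicCompletion F)) //
          AlgPoints.map (S.M.map (homOfLE hle)) y = (AlgPoints.map (S.M.map (homOfLE hNK)) x)},
          ({AlgPoints.map (frobeniusOver 𝒮.reductionAt)
            (𝒮.geomReductionMap (AlgPoints.map (Literature.NumberTheory.Automorphic.Liu2021.AppendixC.recordHeckeTranslateGS S hU7ₛ _ K₁ K ht) y.1))} : Multiset (AlgPoints 𝒮.reductionAt (geomResidueField w))) :=
    (finsum_congr fun α =>
      congrArg (fun P => ({AlgPoints.map (frobeniusOver 𝒮.reductionAt) (𝒮.geomReductionMap P)} : Multiset (AlgPoints 𝒮.reductionAt (geomResidueField w)))) (hliftT α).symm).trans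
      (finsum_comp_equiv (Equiv.ofBijective lift ⟨hinj, hsurj⟩)
        (f := fun y : {y : AlgPoints (S.M.obj K₁) (AlgebraicClosure (w.adicCompletion F)) //
          AlgPoints.map (S.M.map (homOfLE hle)) y = (AlgPoints.map (S.M.map (homOfLE hNK)) x)} =>
          ({AlgPoints.map (frobeniusOver 𝒮.reductionAt)
            (𝒮.geomReductionMap (AlgPoints.map (Literature.NumberTheory.Automorphic.Liu2021.AppendixC.recordHeckeTranslateGS S hU7ₛ _ K₁ K ht) y.1))} : Multiset (AlgPoints 𝒮.reductionAt (geomResidueField w)))))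
  -- the `r₂`-sum is ONE term (§1c)
  have hR := finsum_smul_singleton_translate_eq_of_orbit_subsingleton S hU7ₛ hNK w 𝒮 t₂ ht₂ r₂ hr₂ hrN₂ hdeg₂
    (Ideal.absNorm w.asIdeal) x
  exact hL.trans (hB.trans (congrArg (fun m : Multiset (AlgPoints 𝒮.reductionAt (geomResidueField w)) =>
    ({AlgPoints.map (frobeniusOver 𝒮.reductionAt) (AlgPoints.map (frobeniusOver 𝒮.reductionAt)
        (𝒮.geomReductionMap (AlgPoints.map (S.M.map (homOfLE hNK)) x)))} : Multiset (AlgPoints 𝒮.reductionAt (geomResidueField w))) + m) hR.symm))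

end PenLemmas
end Edition5Desk
end Summit.HodgeConjecture.HodgeConjecture.Cruxes.HLiu418.F0D9opRoad2
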